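import Literature.Computability.QuantumComplexity.PolynomialMethod
import Literature.Computability.Complexity.BooleanFourier
import Literature.Computability.Complexity.FourierDegreeAlgebra
import HarnessLib

/-!
# `Q_T` has DISJOINT-ORTHOGONAL top Fourier vectors (tree model `QQueryAlg`)

Support theorem for route `SosSandwich` (crux `PseudoBoundedAA`, stmt-QuantumAdvantage-15237): the route names, as its
alternative child class after a `K_T` counterexample (which appeared: the address family of
`not_HomogeneousPBAA`), "`K_T ∩` disjoint-orthogonality: `⟨F̂(S), F̂(S′)⟩ = 0` for disjoint top-level `S, S′`, valid
for genuine algorithms".  This file proves that validity in the tree's model: for a `T`-query quantum algorithm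
`A : QQueryAlg N`, the vector-valued Walsh coefficients `v_S = 2^{-N} Σ_x ψ_x χ_S(x)` of the final state
`ψ_x = A.finalState x` satisfy

  `⟨v_S, v_{S'}⟩ = 0` whenever `|S| = |S'| = T` and `S ∩ S' = ∅`   (`finalState_top_disjoint_orthogonal`),

and `v_S = 0` for `|S| > T` (`levelLE_finalState`, Beals et al.'s degree bound in coefficient form).  Proof: one
oracle step acts on coefficients by `(O ψ)^(S) = ½(ψ^(S) + σψ^(S)) + ½(ψ^(S∆{k}) − σψ^(S∆{k}))` on the index-`k`
block (`σ` = target-bit flip; `vfc_oracle`), so it raises the level by one and at the NEW top level `|S| = t+1`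
only `k ∈ S` contributes (`vfc_oracle_top`); two such top vectors for disjoint `S, S'` live on disjoint index
blocks, hence are orthogonal, and the last unitary preserves inner products.  Sorry-free; generic (a librarian may
relocate it under `Literature/Computability/QuantumComplexity/`).

Sources: BealsEtAl2001 Lemma 4.1; AaronsonAmbainis2014 §4 (structure of quantum acceptance polynomials);
EscuderoGutierrez2023 (arXiv:2304.06713) §4 (completely bounded / orthogonality structure).
-/

noncomputable section

set_option linter.dupNamespace false

namespace Summit.QuantumAdvantage.QuantumAdvantage.Theorems.SosSandwich.QueryFourier

open Matrix Finset Literature.Computability.Cryptography Literature.Computability.QuantumComplexity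
open Literature.Computability.Complexity.LowDegree Literature.Probability.RandomGraphs.LowDegree
open scoped symmDiff

variable {N : ℕ} {β : Type*}

/-! ### Vector-valued Walsh coefficients of an input-dependent state -/

/-- The `S`-th Walsh coefficient of an input-dependent complex vector `ψ : x ↦ ψ_x ∈ ℂ^β`:
`v_S = 2^{-N} Σ_x ψ_x χ_S(x)`. [cite: ODonnell2014, §1.2] -/
def vfc (ψ : (Fin N → Bool) → β → ℂ) (S : Finset (Fin N)) : β → ℂ :=
  fun s => (∑ x, ψ x s * (walsh S x : ℂ)) / 2 ^ N

/-- Linearity: coefficients commute with a fixed matrix. [folklore] -/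
theorem vfc_mulVec [Fintype β] (M : Matrix β β ℂ) (ψ : (Fin N → Bool) → β → ℂ) (S : Finset (Fin N)) :
    vfc (fun x => M *ᵥ ψ x) S = M *ᵥ vfc ψ S := by
  funext s
  simp only [vfc, Matrix.mulVec, dotProduct]
  have e : ∀ t, M s t * ((∑ x : Fin N → Bool, ψ x t * (walsh S x : ℂ)) / 2 ^ N) =
      (∑ x : Fin N → Bool, M s t * (ψ x t * (walsh S x : ℂ))) / 2 ^ N := fun t => by
    rw [mul_div_assoc', Finset.mul_sum]
  simp_rw [e]
  rw [← Finset.sum_div]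
  congr 1
  rw [Finset.sum_comm]
  refine Finset.sum_congr rfl fun x _ => ?_
  rw [Finset.sum_mul]
  exact Finset.sum_congr rfl fun t _ => by ring

/-- A fixed matrix preserves the Walsh level ("all coefficients above `t` vanish"). [folklore] -/
theorem level_mulVec [Fintype β] {t : ℕ} {ψ : (Fin N → Bool) → β → ℂ}
    (h : ∀ S : Finset (Fin N), t < S.card → vfc ψ S = 0) (M : Matrix β β ℂ) :
    ∀ S : Finset (Fin N), t < S.card → vfc (fun x => M *ᵥ ψ x) S = 0 := fun S hS => by
  rw [vfc_mulVec, h S hS, Matrix.mulVec_zero]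

/-- A constant state has Walsh level `0`. [cite: ODonnell2014, §1.2] -/
theorem level_const (v : β → ℂ) :
    ∀ S : Finset (Fin N), 0 < S.card → vfc (fun _ : Fin N → Bool => v) S = 0 := by
  intro S hS
  funext s
  simp only [vfc, Pi.zero_apply]
  rw [← Finset.mul_sum]
  have h0 : S ≠ ∅ := by rintro rfl; simp at hS
  have h := sum_walsh_mul_walsh_index S (∅ : Finset (Fin N))
  simp only [walsh_empty, mul_one, if_neg h0] at h
  have hc : (∑ x : Fin N → Bool, (walsh S x : ℂ)) = ((∑ x : Fin N → Bool, walsh S x : ℝ) : ℂ) := by push_cast; rfl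
  rw [hc, h]
  simp

/-! ### One oracle step in coefficients -/

section Oracle

variable {W : Type*} [Fintype W] [DecidableEq W]

/-- Sign form of the XOR-oracle: `(O_x ψ)(k,b,w) = ½(1 + χ_k) ψ(k,b,w) + ½(1 − χ_k) ψ(k,¬b,w)`,
`χ_k(x) = (−1)^{x_k}`. [cite: BealsEtAl2001, Lemma 4.1 (proof)] -/
theorem oracle_sign_form (x : Fin N → Bool) (φ : Fin N × Bool × W → ℂ) (k : Fin N) (b : Bool) (w : W) :
    (queryOracle x *ᵥ φ) (k, b, w) =
      (1 + (walsh {k} x : ℂ)) / 2 * φ (k, b, w) + (1 - (walsh {k} x : ℂ)) / 2 * φ (k, !b, w) := by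
  rw [queryOracle_mulVec_apply]
  simp only [walsh, Finset.prod_singleton]
  cases hx : x k <;> cases b <;> simp [sgn]

/-- **The oracle step on Walsh coefficients**:
`(Oψ)^(S)(k,b,w) = ½(ψ^(S)(k,b,w) + ψ^(S)(k,¬b,w)) + ½(ψ^(S∆{k})(k,b,w) − ψ^(S∆{k})(k,¬b,w))`.
[cite: BealsEtAl2001, Lemma 4.1 (proof)] -/
theorem vfc_oracle (ψ : (Fin N → Bool) → Fin N × Bool × W → ℂ) (S : Finset (Fin N)) (k : Fin N) (b : Bool)
    (w : W) :
    vfc (fun x => queryOracle x *ᵥ ψ x) S (k, b, w) =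
      (vfc ψ S (k, b, w) + vfc ψ S (k, !b, w)) / 2 +
        (vfc ψ (S ∆ {k}) (k, b, w) - vfc ψ (S ∆ {k}) (k, !b, w)) / 2 := by
  simp only [vfc]
  have hmul : ∀ x : Fin N → Bool, (walsh {k} x : ℂ) * (walsh S x : ℂ) = (walsh (S ∆ {k}) x : ℂ) := fun x => by
    rw [← Complex.ofReal_mul, mul_comm, walsh_mul_walsh]
  have e : ∀ x : Fin N → Bool, (queryOracle x *ᵥ ψ x) (k, b, w) * (walsh S x : ℂ) =
      ((ψ x (k, b, w) * (walsh S x : ℂ) + ψ x (k, !b, w) * (walsh S x : ℂ)) / 2 +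
        (ψ x (k, b, w) * (walsh (S ∆ {k}) x : ℂ) - ψ x (k, !b, w) * (walsh (S ∆ {k}) x : ℂ)) / 2) := by
    intro x
    rw [oracle_sign_form, ← hmul]
    ring
  simp_rw [e]
  rw [Finset.sum_add_distrib, ← Finset.sum_div, ← Finset.sum_div, Finset.sum_add_distrib, Finset.sum_sub_distrib]
  ring

/-- One query raises the Walsh level by at most one. [cite: BealsEtAl2001, Lemma 4.1] -/
theorem level_oracle {t : ℕ} {ψ : (Fin N → Bool) → Fin N × Bool × W → ℂ}
    (h : ∀ S : Finset (Fin N), t < S.card → vfc ψ S = 0) :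
    ∀ S : Finset (Fin N), t + 1 < S.card → vfc (fun x => queryOracle x *ᵥ ψ x) S = 0 := by
  intro S hS
  funext s
  obtain ⟨k, b, w⟩ := s
  rw [vfc_oracle, h S (by omega), Pi.zero_apply]
  have hk : t < (S ∆ {k}).card := by
    by_cases hkS : k ∈ S
    · have : S ∆ {k} = S.erase k := by
        ext j; by_cases hj : j = k <;> simp [Finset.mem_symmDiff, hj, hkS]
      rw [this, Finset.card_erase_of_mem hkS]; omega
    · have : S ∆ {k} = insert k S := by
        ext j; by_cases hj : j = k <;> simp [Finset.mem_symmDiff, hj, hkS]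
      rw [this, Finset.card_insert_of_notMem hkS]; omega
  rw [h _ hk]
  simp

/-- **At the new top level only the queried index's block survives**: if `ψ` has level `≤ t` and `|S| = t+1`,
then `(Oψ)^(S)(k,b,w) = [k ∈ S]·½(ψ^(S∖k)(k,b,w) − ψ^(S∖k)(k,¬b,w))`. [cite: BealsEtAl2001, Lemma 4.1 (proof)] -/
theorem vfc_oracle_top {t : ℕ} {ψ : (Fin N → Bool) → Fin N × Bool × W → ℂ}
    (h : ∀ S : Finset (Fin N), t < S.card → vfc ψ S = 0) {S : Finset (Fin N)} (hS : S.card = t + 1) (k : Fin N) (b : Bool) (w : W) :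
    vfc (fun x => queryOracle x *ᵥ ψ x) S (k, b, w) =
      if k ∈ S then (vfc ψ (S.erase k) (k, b, w) - vfc ψ (S.erase k) (k, !b, w)) / 2 else 0 := by
  rw [vfc_oracle, h S (by omega), Pi.zero_apply, Pi.zero_apply, zero_add, zero_div, zero_add]
  by_cases hkS : k ∈ S
  · have : S ∆ {k} = S.erase k := by
      ext j; by_cases hj : j = k <;> simp [Finset.mem_symmDiff, hj, hkS]
    rw [if_pos hkS, this]
  · have : S ∆ {k} = insert k S := by
      ext j; by_cases hj : j = k <;> simp [Finset.mem_symmDiff, hj, hkS]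
    rw [if_neg hkS, this, h _ (by rw [Finset.card_insert_of_notMem hkS]; omega)]
    simp

/-- Two new-top-level vectors for DISJOINT sets are orthogonal (they live on disjoint index blocks).
[cite: BealsEtAl2001, Lemma 4.1 (proof)] -/
theorem vfc_oracle_top_orthogonal {t : ℕ} {ψ : (Fin N → Bool) → Fin N × Bool × W → ℂ}
    (h : ∀ S : Finset (Fin N), t < S.card → vfc ψ S = 0) {S S' : Finset (Fin N)} (hS : S.card = t + 1) (hS' : S'.card = t + 1) (hdisj : Disjoint S S') :
    star (vfc (fun x => queryOracle x *ᵥ ψ x) S) ⬝ᵥ vfc (fun x => queryOracle x *ᵥ ψ x) S' = 0 := by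
  simp only [dotProduct, Pi.star_apply]
  refine Finset.sum_eq_zero fun s _ => ?_
  obtain ⟨k, b, w⟩ := s
  rw [vfc_oracle_top h hS, vfc_oracle_top h hS']
  by_cases hk : k ∈ S
  · have hk' : k ∉ S' := Finset.disjoint_left.mp hdisj hk
    rw [if_neg hk', mul_zero]
  · rw [if_neg hk, star_zero, zero_mul]

end Oracle

/-! ### The final state of a query algorithm -/

/-- Unitaries preserve the inner product `⟨u, v⟩ = star u ⬝ v`. [folklore] -/
theorem star_mulVec_dotProduct_mulVec [Fintype β] [DecidableEq β] {U : Matrix β β ℂ}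
    (hU : U ∈ Matrix.unitaryGroup β ℂ) (u v : β → ℂ) : star (U *ᵥ u) ⬝ᵥ (U *ᵥ v) = star u ⬝ᵥ v := by
  rw [Matrix.star_mulVec, ← Matrix.dotProduct_mulVec, Matrix.mulVec_mulVec]
  have : Uᴴ * U = 1 := by
    rw [← Matrix.star_eq_conjTranspose]; exact Matrix.mem_unitaryGroup_iff'.mp hU
  rw [this, Matrix.one_mulVec]

/-- **The fold invariant**: after `j` steps `Ψ ↦ U_{j+1}(O Ψ)` from the constant `U_0 e_start`, the state has
Walsh level `≤ j`, and (for `j ≥ 1`) its level-`j` vectors at DISJOINT sets are orthogonal.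
[cite: BealsEtAl2001, Lemma 4.1] -/
theorem fold_invariant (A : QQueryAlg N) :
    (∀ S : Finset (Fin N), A.queries < S.card → vfc (fun x => A.finalState x) S = 0) ∧
    (1 ≤ A.queries → ∀ S S' : Finset (Fin N), S.card = A.queries → S'.card = A.queries → Disjoint S S' →
      star (vfc (fun x => A.finalState x) S) ⬝ᵥ vfc (fun x => A.finalState x) S' = 0) := by
  -- the step and initial datum of the function-level fold
  let step : ((Fin N → Bool) → Fin N × Bool × A.W → ℂ) → Fin A.queries →
      ((Fin N → Bool) → Fin N × Bool × A.W → ℂ) :=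
    fun Ψ j => fun b => (A.unitaries j.succ).1 *ᵥ (queryOracle b *ᵥ Ψ b)
  let init : (Fin N → Bool) → Fin N × Bool × A.W → ℂ := fun _ => (A.unitaries 0).1 *ᵥ Pi.single A.start 1
  -- the invariant
  let P : ℕ → ((Fin N → Bool) → Fin N × Bool × A.W → ℂ) → Prop := fun j Ψ =>
    (∀ S : Finset (Fin N), j < S.card → vfc Ψ S = 0) ∧
    (1 ≤ j → ∀ S S' : Finset (Fin N), S.card = j → S'.card = j → Disjoint S S' →
      star (vfc Ψ S) ⬝ᵥ vfc Ψ S' = 0)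
  have h0 : P 0 init := ⟨level_mulVec (level_const _) _, fun h => absurd h (by norm_num)⟩
  have hstep : ∀ (j : Fin A.queries) (Ψ : (Fin N → Bool) → Fin N × Bool × A.W → ℂ),
      P j Ψ → P (j + 1) (step Ψ j) := by
    rintro j Ψ ⟨hlev, -⟩
    refine ⟨level_mulVec (level_oracle hlev) _, fun _ S S' hS hS' hd => ?_⟩
    change star (vfc (fun b => (A.unitaries j.succ).1 *ᵥ (queryOracle b *ᵥ Ψ b)) S) ⬝ᵥ
        vfc (fun b => (A.unitaries j.succ).1 *ᵥ (queryOracle b *ᵥ Ψ b)) S' = 0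
    rw [vfc_mulVec, vfc_mulVec, star_mulVec_dotProduct_mulVec (A.unitaries j.succ).2]
    exact vfc_oracle_top_orthogonal hlev hS hS' hd
  have key : P A.queries (Fin.foldl A.queries step init) := foldl_invariant A.queries step init P h0 hstep
  have e : (fun x => A.finalState x) = Fin.foldl A.queries step init :=
    foldl_pi A.queries (fun (x : Fin N → Bool) (ψ : Fin N × Bool × A.W → ℂ) (j : Fin A.queries) =>
      (A.unitaries j.succ).1 *ᵥ (queryOracle x *ᵥ ψ)) (fun _ => (A.unitaries 0).1 *ᵥ Pi.single A.start 1)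
  rw [e]
  exact key

/-- **Beals et al. in coefficient form**: the final state of a `T`-query algorithm has Walsh level `≤ T`.
[cite: BealsEtAl2001, Lemma 4.1] -/
theorem level_finalState (A : QQueryAlg N) (S : Finset (Fin N)) (hS : A.queries < S.card) :
    vfc (fun x => A.finalState x) S = 0 :=
  (fold_invariant A).1 S hS

/-- **Disjoint-orthogonality of the top Fourier vectors of a quantum query algorithm.**  For a `T`-query
algorithm (`T ≥ 1`) and disjoint `S, S'` with `|S| = |S'| = T`, the vector Walsh coefficients of the final state
are orthogonal: `⟨v_S, v_{S'}⟩ = 0`.  (The route's "disjoint-orthogonality" property of GENUINE algorithms, which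
a flat `K_T` Gram matrix need not have.) [cite: BealsEtAl2001, Lemma 4.1] [cite: AaronsonAmbainis2014, §4] -/
theorem finalState_top_disjoint_orthogonal (A : QQueryAlg N) (hT : 1 ≤ A.queries) {S S' : Finset (Fin N)}
    (hS : S.card = A.queries) (hS' : S'.card = A.queries) (hdisj : Disjoint S S') :
    star (vfc (fun x => A.finalState x) S) ⬝ᵥ vfc (fun x => A.finalState x) S' = 0 :=
  (fold_invariant A).2 hT S S' hS hS' hdisj

/-! ### Parseval for the vector coefficients: `Σ_S ‖v_S‖² = E_x ‖ψ_x‖²` (= 1 for a final state) -/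

/-- **Parseval, complex vector form**: `Σ_S ⟨v_S, v_S⟩ = 2^{-N} Σ_x ⟨ψ_x, ψ_x⟩`. [cite: ODonnell2014, §1.4] -/
theorem sum_vfc_dotProduct [Fintype β] (ψ : (Fin N → Bool) → β → ℂ) :
    ∑ S : Finset (Fin N), star (vfc ψ S) ⬝ᵥ vfc ψ S = (∑ x, star (ψ x) ⬝ᵥ ψ x) / 2 ^ N := by
  have h2 : (2 : ℂ) ^ N ≠ 0 := pow_ne_zero _ two_ne_zero
  -- expand both sides into quadruple sums
  have lhs : ∀ S : Finset (Fin N), star (vfc ψ S) ⬝ᵥ vfc ψ S =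
      (∑ s, ∑ x, ∑ y, star (ψ x s) * ψ y s * ((walsh S x : ℂ) * (walsh S y : ℂ))) / (2 ^ N * 2 ^ N) := by
    intro S
    simp only [dotProduct, Pi.star_apply, vfc]
    rw [Finset.sum_div]
    refine Finset.sum_congr rfl fun s _ => ?_
    rw [star_div₀, star_sum, div_mul_div_comm, Finset.sum_mul_sum]
    congr 1
    · refine Finset.sum_congr rfl fun x _ => Finset.sum_congr rfl fun y _ => ?_
      rw [star_mul, Complex.star_def, Complex.conj_ofReal]
      ring
    · rw [Complex.star_def, map_pow, map_ofNat]
  simp_rw [lhs]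
  rw [← Finset.sum_div]
  rw [div_eq_div_iff (mul_ne_zero h2 h2) h2]
  -- swap the `S`-sum inside and use `Σ_S χ_S(x) χ_S(y) = 2^N [x = y]`
  have inner : ∀ (s : β) (x y : Fin N → Bool),
      ∑ S : Finset (Fin N), star (ψ x s) * ψ y s * ((walsh S x : ℂ) * (walsh S y : ℂ)) =
        if x = y then star (ψ x s) * ψ y s * 2 ^ N else 0 := by
    intro s x y
    rw [← Finset.mul_sum]
    have hw : ∑ S : Finset (Fin N), (walsh S x : ℂ) * (walsh S y : ℂ) =
        ((∑ S : Finset (Fin N), walsh S x * walsh S y : ℝ) : ℂ) := by push_cast; rfl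
    rw [hw, sum_walsh_mul_walsh, Fintype.card_fin]
    split_ifs <;> simp
  calc (∑ S : Finset (Fin N), ∑ s, ∑ x, ∑ y, star (ψ x s) * ψ y s * ((walsh S x : ℂ) * (walsh S y : ℂ))) * 2 ^ N
      = (∑ s, ∑ x, ∑ y, ∑ S : Finset (Fin N), star (ψ x s) * ψ y s * ((walsh S x : ℂ) * (walsh S y : ℂ))) * 2 ^ N := by
        congr 1
        rw [Finset.sum_comm]
        refine Finset.sum_congr rfl fun s _ => ?_
        rw [Finset.sum_comm]
        refine Finset.sum_congr rfl fun x _ => ?_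
        rw [Finset.sum_comm]
    _ = (∑ s, ∑ x, star (ψ x s) * ψ x s * 2 ^ N) * 2 ^ N := by
        congr 1
        refine Finset.sum_congr rfl fun s _ => Finset.sum_congr rfl fun x _ => ?_
        simp_rw [inner]
        rw [Finset.sum_ite_eq Finset.univ x]
        simp
    _ = (∑ x, star (ψ x) ⬝ᵥ ψ x) * (2 ^ N * 2 ^ N) := by
        rw [Finset.sum_comm]
        simp only [dotProduct, Pi.star_apply, Finset.sum_mul]
        refine Finset.sum_congr rfl fun x _ => Finset.sum_congr rfl fun s _ => ?_
        ring

/-- **Parseval, norm form**: `Σ_S Σ_s ‖v_S(s)‖² = 2^{-N} Σ_x Σ_s ‖ψ_x(s)‖²`. [cite: ODonnell2014, §1.4] -/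
theorem sum_vfc_norm_sq [Fintype β] (ψ : (Fin N → Bool) → β → ℂ) :
    ∑ S : Finset (Fin N), ∑ s, ‖vfc ψ S s‖ ^ 2 = (∑ x, ∑ s, ‖ψ x s‖ ^ 2) / 2 ^ N := by
  have h := congrArg Complex.re (sum_vfc_dotProduct ψ)
  rw [Complex.re_sum] at h
  simp_rw [← sum_norm_sq_eq_re_dotProduct] at h
  rw [h]
  have e : (∑ x : Fin N → Bool, star (ψ x) ⬝ᵥ ψ x) = ((∑ x : Fin N → Bool, ∑ s, ‖ψ x s‖ ^ 2 : ℝ) : ℂ) := by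
    push_cast
    refine Finset.sum_congr rfl fun x _ => ?_
    simp only [dotProduct, Pi.star_apply]
    refine Finset.sum_congr rfl fun s _ => ?_
    rw [Complex.star_def, Complex.conj_mul']
  rw [e]
  have : ((2 : ℂ) ^ N) = ((2 ^ N : ℝ) : ℂ) := by push_cast; rfl
  rw [this, ← Complex.ofReal_div, Complex.ofReal_re]

/-- **The top vectors of a query algorithm form a Bessel system**: `Σ_S ‖v_S‖² = 1` for the final state
(unit vectors for every input). [cite: BealsEtAl2001, §2] -/
theorem sum_vfc_finalState_norm_sq (A : QQueryAlg N) :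
    ∑ S : Finset (Fin N), ∑ s, ‖vfc (fun x => A.finalState x) S s‖ ^ 2 = 1 := by
  rw [sum_vfc_norm_sq]
  simp_rw [sum_norm_sq_finalState]
  rw [Finset.sum_const, Finset.card_univ, Fintype.card_fun, Fintype.card_bool, Fintype.card_fin, nsmul_eq_mul,
    mul_one]
  push_cast
  exact div_self (by positivity)

end Summit.QuantumAdvantage.QuantumAdvantage.Theorems.SosSandwich.QueryFourier

end
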